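import Mathlib
import HarnessLib
import HarnessLib.Audit
import Summits.AtomisticToContinuum.Statement
import Literature.MathematicalPhysics.KineticTheory.StochasticCollisionHardSphereProcess
import HarnessLib.Audit.Status.Attr

/-!
Route: GolfBallDice

DORMANT since 2026-08-22T10:41:10Z (reconciler: no traction for 5.3 d (last activity item-evidence-added at 2026-08-17T03:20:58Z); parked, not closed — `ledger route dormant route-AtomisticToContinuum-GolfBallDice --off` to reactivate) — unstaffed, not closed; items shared with open routes are served there. `ledger route dormant <id> --off` reactivates.

# Route GolfBallDice — golf-ball gas — studs derandomise collisions; gapped kernel gas, exact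
coupling, shape stability at the sphere

It suffices to show X = X₁ ∧ X₂ (card golf-ball-gas-dimple-dice, spine; gen 2 of the retired route
GolfBallGas, now with a
deciding theorem). A SHAPE SCHEDULE is Ψ_N : ℝ³ → ℝ³ measurable, odd, positively 1-homogeneous with
(1−a_N)|r| ≤ |Ψ_N r| ≤ (1+a_N)|r|,
angle(Ψ_N r, r) ≤ s_N, a_N, s_N → 0; the SHAPE GAS is the configuration-space billiard of N+1 point
particles on 𝕋³ with the symmetric
pair-exclusion body B_N = {|Ψ_N r| < ε_N}, ε_N = σ(N+1)^(-1/3) (fixed reduced density), reflecting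
specularly about Ψ_N(x_i − x_j) — typed
without new definitions as `HardSphereFlow` of the geometry sepVec ↦ Ψ_N ∘ sepVec, with local Gibbs
law `particleLaw Φ' (canonicalDensity ⟨…Ψ_N…⟩ …)`.
X₁ = ShapeGasEulerLimit: SOME schedule (intended: GOLF BALLS, B_N = ball(ε_N) ∪ symmetric convex
studs of width w_N ≤ ε_N e^(−N²) and
slope s_N = N^(−1/12)) has flows for every N and satisfies the conjunct's conclusion verbatim (local
Gibbs LLN at t = 0 ⇒ LLN of the
density/momentum/energy fields at every pre-shock t); it is reached through the typed rung
KernelGasEulerLimit → GolfRealisation →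
ShapeGasEulerLimit (stages 2–4 of `closes`). X₂ = ShapeStability: for EVERY schedule, pre-shock weak
merging of the laws of the χ-tested
hydrodynamic fields of smooth spheres and of the shape gas. X₂ docks X₁ to HydrodynamicLimit
(packing-guarded conjunct, by name) by the bounded-continuous sandwich (stages 1 and 5 of `closes`).
Since the
Statement re-type (p126922, 2026-08-16) X₁, X₂ and the rung's KernelGasEulerLimit carry the
conjunct's packing guard verbatim (dilute-fluid chamber).
Lean: `ShapeGasEulerLimit ∧ ShapeStability`

## Assembly
The deciding theorem (glue.lean rev 6, route-repair d034e044, 2026-08-17; CRUX-ONLY — lint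
glue.non-crux-hypothesis cleared) is
`closes (h₂ : GolfRealisation) (h₃ : ShapeStability) (h₄ : KernelGasEulerLimit) :
_root_.HydrodynamicLimit`, ≈ 180 lines, sorry-free,
axioms {propext, Classical.choice, Quot.sound}; its conclusion is the PACKING-GUARDED conjunct by
name, the guard being carried by the
Euler-limit items themselves (not discharged by `HydrodynamicLimit.of_unguarded`). The measure
theory formerly delegated to the supports
MergingTransfer / RungDock / ShapeDock is proved INLINE: `key` — Markov with the cutoff φ_δ(r) = min
1 (max 0 (2r/δ − 1)) plus
bounded-continuous merging between two sequences of FINITE laws turns ν_N{δ' < Y_N} → 0 (∀δ') into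
μ_N{δ < X_N} → 0; `xfer` — its
three-field, two-way form keyed to the items' `(∀ Fr …) ∧ (∀ Fv …)` packages; `hfin` — every
canonical law Z⁻¹ 1_D f₀^⊗n dZ of ANY
pair-exclusion geometry at ANY σ has finite mass (Z ≠ 0 ⇒ the density is integrable, Z = 0 ⇒ junk
density 0), hence so have the sphere
local Gibbs law, the shape-gas `particleLaw` and `kernelGasLawAt` (push-forward of the product with
`unitDice`) — no σ ≤ 1/2 needed;
`hm` — measurability of the χ-tested fields (finite Dirac averages, `empiricalMeasure_eq`) along
measurable flows. Logic: η₀ := min η₁ η₂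
(η₁ from KernelGasEulerLimit at the golf kernels κ_N, q_N of GolfRealisation, η₂ from ShapeStability
at the golf schedule Ψ_N), σ₀ := min of
the three σ₀'s, shape flows Φ'_N := choice (GolfRealisation (i)); for t ∈ [0,T): sphere LLN at 0 ⟹
(ShapeStability at 0) shape LLN at 0 ⟹
(GolfRealisation (ii) at 0) kernel-gas LLN at 0 ⟹ (KernelGasEulerLimit, guard at η₁) kernel-gas LLN
at t ⟹ (GolfRealisation (ii) at t)
shape LLN at t ⟹ (ShapeStability at t, guard at η₂) `TendstoHydroFieldsAt (localGibbsLaw …) Φ ρ u θ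
t`. The rev 4–5 docking items RungDock,
ShapeDock are dropped as subsumed by `closes`; the item Assembly (GolfRealisation → ShapeStability →
KernelGasEulerLimit →
HydrodynamicLimit, literally the type of `closes`) is kept and is provable as `theorem
assembly_holds : Assembly := closes`;
MergingTransfer stays filed as an optional reusable support.

Rationale: WHY THIS LINE. Everyone adds the dice by hand (OllaVaradhanYau1993 bulk velocity noise;
Rezakhanlou2003 stochastic collision kernels; route VanishingNoise's
HS(p_N)); the golf ball MANUFACTURES them: a corrugation of the pair-exclusion body of width w ≪ ε
and slope s makes fine impact position ↦
outgoing direction an EXPANDING map (factor ≍ sε/w), so the positional uncertainty δ ≫ w created by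
one free flight is converted into a draw
from a fixed flux-reciprocal Markov kernel κ_N with total-variation error O(w/δ) — Feres' derivation
of random reflection operators from
deterministic wall microstructure (Feres2007, FeresYablonsky2004; small-roughness limit
FeresZhang2010; spectral gap FeresZhang2012;
rough-body scattering Plakhov2009; Knudsen billiard invariance/reversibility CometsEtAl2008 Thm
2.4–2.5) transplanted from one particle at a
wall to PAIR collisions in the N-body gas, with the cell-averaging engine filed as
TwoScaleCellAveraging and, new in gen 2, the kernel gas
HS(κ) typed on the landed `StochasticCollisionHardSphereProcess` (kernelGasLawAt, fluxIn/fluxOut,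
IsFluxReciprocal). Two twists make the
rung honest: w_N is FREE, so it is taken super-exponentially small and the coupling golf gas ↔
HS(κ_N) is EXACT below the collision-count
scale (no mixing rate, no standard pairs, no BFK bound — collisions are counted along the coupled
kernel gas, whose Gibbs law is
stationary), and OVY's weak-noise window becomes a SPECTRAL-GAP WINDOW q_N(N+1)^(1/3) → ∞ for the
one-collision operator in L²(flux)
(HS(p): q = 1 − p²; slope-s studs: q ≍ s²), so one typed statement KernelGasEulerLimit covers
VanishingNoise's RareDiceEuler and the
golf kernels at once. Imported areas: random / semi-dispersing billiards (dynamical systems),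
spectral gaps of Markov operators
(functional analysis), the OVY relative-entropy architecture with conservative noise (probability),
weak merging of laws (measure theory).
What no prior route has: a deterministic, reversible, Liouville, momentum- and energy-conserving
hard-particle gas whose fixed-density
Euler limit reduces EXACTLY to the stochastic rung the board rates reachable (X₁ would be the first
such theorem), and the conjunct
isolated as one clean statement — continuity of pre-shock hydrodynamic statistics in the grain shape
AT the sphere (ShapeStability, the
deterministic sibling of VanishingNoise's DiceContinuity) — instead of vanishing extraneous noise or
hyperbolicity of free flight.

RANKED CRUXES. STATEMENT RE-TYPE 2026-08-16 (p126922, D-0032; route-repair d1e0a456, revs 2–4): the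
conjunct is now PACKING-GUARDED and the guard is propagated verbatim into the three Euler-limit
items (#3, #4, ShapeGasEulerLimit) — `∃ η₀ > 0` after the schedule / kernel prefix, `(∀ t ∈ Ico 0 T,
∀ x, ρ t x * σ ^ 3 < η₀) →` after the solution hypothesis — so no item of this route speaks about
dense-excursion / imploding classical solutions any more (audit §2.28/§3.1: the σ₀-before-T caveat
is gone from the route, not merely from its target); GolfRealisation, MergingTransfer,
TwoScaleCellAveraging are untouched (no Euler data enter them). #2 GolfRealisation (crux) — (card
G1+G2 with Feres' theorem for gases, typed) there exist a shape schedule (Ψ_N, a_N, s_N) and Markov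
collision kernels κ_N on S² — outgoing-supported, flux-reciprocal, with a UNIFORM one-collision
L²(flux) spectral gap q_N ∈ (0,1] (∫(P_ω f)² dfluxIn ≤ (1−q_N)∫f² dfluxOut for bounded
fluxOut-mean-zero f, every unit axis ω) in the window q_N(N+1)^(1/3) → ∞ — such that for all
continuous positive profiles ∃σ₀ ∀σ ∈ (0,σ₀): (i) the Ψ_N-billiard (`HardSphereFlow` of the
Ψ_N-geometry) exists for every N, and (ii) for every t ≥ 0 and continuous χ the laws of the χ-tested
empirical density / momentum / energy fields of the shape gas at time t (from its own local Gibbs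
law) and of the kernel gas HS(κ_N) at time t (`kernelGasLawAt`, started from the sphere local Gibbs
law) merge weakly: expectations of every bounded continuous F differ by o(1). Intended witness: golf
balls (studs of width w_N ≤ ε_N e^(−N²), slope s_N = N^(−1/12)), κ_N = the cell-averaged stud
reflection law, q_N ≍ s_N²; intended proof: flows (Alexander for a finite union of convex
ball-cylinders) + stud-kernel reciprocity/gap + exact coupling (one-flight freshness at scale ≫ w_N
via TwoScaleCellAveraging, encounters counted along the coupled kernel gas). [deps:
TwoScaleCellAveraging] [difficulty: XL] (why it might fail: The cell-averaged stud kernel may lose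
its L²(flux) gap UNIFORMLY in the axis/incidence (grazing rays see only stud tops: shadowing),
leaving q_N ≪ s_N²; and the coupling needs E[#encounters ∧ coupled] ≤ e^(CN)·N^(4/3)t via
stationarity of Gibbs under HS(κ_N).) [Feres2007, FeresZhang2012, FeresZhang2010, CookFeres2012,
CometsEtAl2008, Plakhov2009, Alexander1975, BuragoFerlegerKononenko1998]
#3 ShapeStability (crux) — (card G4, deterministic form — PACKING-GUARDED since the Statement
re-type p126922 / D-0032, 2026-08-16) for EVERY shape schedule there is a packing threshold η₀ > 0
such that, for all continuous positive profiles, ∃σ₀ ∀σ ∈ (0,σ₀), for every classical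
hard-sphere-Euler solution on [0,T) whose local packing fraction stays below η₀ (∀ t ∈ [0,T), ∀ x,
ρ_t(x)σ³ < η₀, verbatim the conjunct's guard), every family of sphere flows Φ and shape flows Φ': if
the SPHERE local Gibbs fields converge at t = 0, then for every t ∈ [0,T), every continuous χ and
every bounded continuous F, E_sphere[F(density field_χ(t))] − E_shape[F(density field_χ(t))] → 0,
likewise for the energy field and, with bounded continuous F : ℝ³ → ℝ, for the momentum field (weak
merging of the laws of the hydrodynamic observables in the dilute-fluid chamber — near packing the
grain shape is NOT a small perturbation, so the unguarded form was over-strong in the same way the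
old conjunct was; t = 0 is the statics: same activity/velocity/temperature profiles, exclusion
bodies within relative Hausdorff distance a_N → 0). [difficulty: open-problem] (why it might fail:
Trajectories of the two gases decorrelate after one mean free time N^(-1/3) and no law-level
structural-stability theory exists; it is FALSE exactly if smooth spheres keep non-hydrodynamic slow
structure (fail macro-ergodicity) in the dilute band that every vanishing roughness destroys.)
[OllaVaradhanYau1993, Spohn1991, Simanyi2013, CanestrariLiveraniOlla2026, LampisPetrinaPetrina1999,
BaladiDemersLiverani2017]
#4 KernelGasEulerLimit (crux) — (card G3, the stochastic rung — PACKING-GUARDED since the Statement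
re-type p126922 / D-0032, 2026-08-16; generalises VanishingNoise's RareDiceEuler from the
specular/Lambert mixture HS(p_N) to the class the golf kernels live in) for every sequence of Markov
collision kernels κ_N that are outgoing-supported and flux-reciprocal with a uniform one-collision
L²(flux) spectral gap q_N ∈ (0,1] in the window q_N(N+1)^(1/3) → ∞ there is a packing threshold η₀ >
0 such that, for all continuous positive profiles, ∃σ₀ ∀σ ∈ (0,σ₀), for every classical
hard-sphere-Euler solution on [0,T) WHOSE LOCAL PACKING FRACTION STAYS BELOW η₀ (∀ t ∈ [0,T), ∀ x,
ρ_t(x)σ³ < η₀ — verbatim the conjunct's guard: the dilute-fluid chamber where the virial EOS is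
analytic and OVY's thermodynamics applies; imploding / dense-excursion solutions are outside the
item exactly as they are outside the conjunct): if under the time-0 law of HS(κ_N) (N+1 spheres of
diameter σ(N+1)^(-1/3) on 𝕋³, `kernelGasLawAt … 0` from the sphere local Gibbs law) the χ-tested
empirical density/momentum/energy fields converge in probability to (ρ, ρu, E)(0), then under the
time-t law they converge to (ρ, ρu, E)(t) for every t < T. Same EOS p = ρθZ(ρσ³): flux reciprocity
makes Liouville ⊗ Maxwell and the hard-core Gibbs laws invariant and the flux-mean momentum transfer
at contact equal to the specular one (OVY Thm 2.1 / Cor. 2.2 transplanted to contact-localised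
reciprocal kernels with the true kinetic energy). Non-vacuity of the kernel-side hypotheses: the
refuter's LambertWitness.lean (evidence on this item, κ_N = Lambert, q_N = 1) applies verbatim — the
kernel prefix is unchanged. [difficulty: XL] (why it might fail: OVY's ergodic step used bulk
exchange noise on all near pairs; kernel noise charges only the collision boundary (zero contact
Dirichlet form ⇒ kernel-invariant traces must reach Gibbs through free flight — unproved), and the
cubic energy current with Gaussian tails is the open input.) [OllaVaradhanYau1993, LiveraniOlla1996,
FritzFunakiLebowitz1994, Rezakhanlou2003, CometsEtAl2008, CookFeres2012]
#9 ShapeGasEulerLimit (support) — (the rung X₁ — PACKING-GUARDED since the Statement re-type p126922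
/ D-0032, 2026-08-16; follows from KernelGasEulerLimit + GolfRealisation exactly as stages 2–4 of
`closes`, η₀ := the threshold KernelGasEulerLimit yields at the golf kernels — a stand-alone theorem
target, do not staff before its parents) there are a shape schedule and a packing threshold η₀ > 0
such that for all continuous positive profiles ∃σ₀ ∀σ ∈ (0,σ₀): (i) the shape gas of N+1 particles
at diameter σ(N+1)^(-1/3) admits a `HardSphereFlow` of the Ψ_N-geometry for every N, and (ii) for
every classical hard-sphere-Euler solution on [0,T) whose local packing fraction stays below η₀ (∀ t
∈ [0,T), ∀ x, ρ_t(x)σ³ < η₀) and every family of such flows, if the shape-gas local Gibbs fields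
converge in probability at t = 0 then they converge at every t < T (density, momentum, energy; the
format of TendstoHydroFieldsAt, i.e. of the re-typed conjunct with the shape gas in place of the
spheres). [difficulty: XL] [OllaVaradhanYau1993, Spohn1991, Feres2007]
#9 MergingTransfer (support) — (pure measure theory on the (N+1)-particle phase spaces) for finite
measures P_N, Q_N and measurable real (resp. ℝ³-valued) observables X_N, Y_N: if ∫F(X_N)dP_N −
∫F(Y_N)dQ_N → 0 for every bounded continuous F and Y_N → c in Q_N-probability, then X_N → c in
P_N-probability (sandwich 1_(|x−c|>δ) ≤ F_δ ≤ 1_(|x−c|>δ/2)). [difficulty: provable-now]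
[KipnisLandim1999, Folland1999]
#9 TwoScaleCellAveraging (support) — (the derandomising engine, abstract Feres lemma) for a
ℤⁿ-periodic measurable cell map Tm on ℝⁿ (sup norm), |ψ| ≤ 1 measurable, and a density ρ that is
L-Lipschitz and vanishes outside the ball of radius R: |∫ ψ(Tm(x/h)) ρ(x) dx − (∫ρ)·∫_[0,1)ⁿ ψ∘Tm| ≤
2 L h (2R+3)ⁿ for 0 < h ≤ 1 — an observable of the h-rescaled microstructure seen through a density
Lipschitz at scale ≫ h is its cell average up to O(Lh). [difficulty: provable-now] [Feres2007,
FeresYablonsky2004, Plakhov2009]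
#1 Assembly (assembly) — (rev 4, CRUX-ONLY form) GolfRealisation → ShapeStability →
KernelGasEulerLimit → HydrodynamicLimit — the three cruxes alone imply the (packing-guarded)
conjunct; since rev 6 this is literally the type of the deciding theorem, so `theorem assembly_holds
: Assembly := closes` closes it (kept because the gate does not drop assembly items). [difficulty:
XS] [Spohn1991, OllaVaradhanYau1993]

TWO-LAYER PLAN. Foreseen glued splits (k ≤ 3, depth 1), none filed now. GolfRealisation ⇐
GolfFlowExists (Alexander's theorem for the golf pair body: a
finite union of convex ball-cylinders in configuration space, semi-dispersing;
Vaserstein/Galperin/BFK local finiteness of collisions) →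
StudKernel (the cell-averaged stud encounter law is a Markov CollisionKernel, outgoing-supported,
flux-reciprocal (Feres' reciprocity, billiard
map preserves the flux measure) with uniform L²(flux) gap ≥ c·s_N² (Feres–Zhang type; ≤ 2
micro-bounces per encounter by the wedge bound
⌈π/(π−2s)⌉)) → ExactCoupling (golf gas and HS(κ_N) on one space with P(all encounters on [0,t]
coincide in partners and outgoing directions)
→ 1: one-flight freshness of impact parameters at scale ≫ w_N via TwoScaleCellAveraging, encounter
count ≤ e^(CN)N^(4/3)t along the COUPLED
kernel gas by stationarity of its Gibbs law, TV(golf local Gibbs, sphere local Gibbs) =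
O(N^(7/3)σ²s_N w_N/ε_N) → 0; then merging by the
sup-distance O(N^(4/3) s_N w_N) between coupled configurations) → GolfRealisation.
KernelGasEulerLimit ⇐ KernelGibbs (well-posedness: a.s.
finitely many simple collisions; invariance of hard-core Gibbs laws under flux-reciprocal kernels) →
ContactErgodicity (translation-invariant,
finite-entropy-density states with zero contact Dirichlet form are Gibbs mixtures — the
gapped-kernel Liverani–Olla/FFL theorem) →
EntropyGronwall (OVY's relative entropy inequality with contact currents and the velocity-tail
input) → KernelGasEulerLimit.
ShapeStability ⇐ ShapeStatics (t = 0: merging of the Gibbs field laws for exclusion bodies at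
relative Hausdorff distance a_N → 0, low-density
cluster expansion) → ShapeDynamics (t > 0) → ShapeStability.

KILL CRITERIA. ShapeStability refuted (a shape schedule with flows whose pre-shock field laws
provably separate from the spheres', or a theorem that every
vanishing roughness thermalises what smooth spheres provably do not) ⇒ `close --reason
refuted:ShapeStability`; the rung (KernelGasEulerLimit
+ GolfRealisation ⇒ ShapeGasEulerLimit) survives as a stand-alone theorem target and the card is
re-filed as a non-route rung. KernelGasEulerLimit
refuted for the whole gapped reciprocal class (a translation-invariant finite-entropy NON-Gibbs
state with zero contact Dirichlet form, or
Gaussian velocity moments blowing up along HS(κ)) ⇒ VanishingNoise's RareDiceEuler dies with it and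
this route closes refuted:KernelGasEulerLimit;
refuted only for exotic members ⇒ restate for Lambert-minorised / isotropic kernels containing the
stud kernels (new item, not a rewording).
GolfRealisation refuted in its gap clause (every stud/dimple microstructure on a sphere has
one-collision L²(flux) gap o(s²) uniformly, e.g. by
grazing shadowing) ⇒ pivot: replace the uniform gap in BOTH rung items by the flux-averaged
(non-uniform) coercivity the coupling actually
delivers; refuted in its coupling clause (encounters cannot be counted along the coupled kernel gas)
⇒ close. If VanishingNoise's DiceContinuity
is refuted by a mechanism insensitive to whether the perturbation is stochastic or geometric,
ShapeStability is dead in substance — close.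
HydrodynamicLimit proved elsewhere moots the route (the rung stays interesting but is not this
summit's business). RE-TYPE NOTE (2026-08-16): implosion / dense-excursion theorems
(ImplosionDichotomy's DenseExcursion, any σ₀-before-T witness) no longer bear on ANY item of this
route — every Euler-limit item carries the conjunct's packing guard; a refutation of the guarded
items must live in the dilute band (macro-ergodicity failure of smooth spheres that roughness cures,
a non-Gibbs zero-contact-form state of HS(κ), velocity-tail blow-up).

NOT DECOMPOSED YET. Deliberately NOT items at open (layer-2 children or `--supports` lemmas, see
Two-layer plan): Alexander's theorem for the golf pair body;
the stud kernel's measurability/reciprocity/gap (constants c in q_N ≥ c s_N²); the one-flight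
freshness lemma (conditional impact-parameter
densities Lipschitz at scale c·s_N·min(flight, ε_N) off an exceptional class of probability
O(w_N/ℓ)); the encounter-count bound via the
Campbell/Rice collision-intensity formula for the stationary kernel gas and the density bound local
Gibbs ≤ e^(CN) × Gibbs; kernel-gas
well-posedness; the finite-N theorem "golf flow → HS(κ) in law as w → 0, N fixed" (Feres' theorem
for gases; rides with `--supports
GolfRealisation`); the statics of studded bodies (EOS = hard-sphere EOS + O(a_N), LLN of the shape
local Gibbs law); OVY's entropy inequality,
contact currents and the velocity-tail input inside KernelGasEulerLimit; the (h, s) two-parameter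
family and any uniformity-in-s variant;
measurability of the empirical fields. CRUX-ONLY `closes` DONE (rev 6, route-repair d034e044,
2026-08-17): the deciding theorem's hypotheses are exactly the three cruxes; the docking measure
theory (finiteness of every law for a general Ψ-geometry and of `kernelGasLawAt` with no σ ≤ 1/2,
measurability of the fields along the flows, twelve sandwich transfers) is proved inline and the
former docking items RungDock / ShapeDock are dropped (the item Assembly, = the type of `closes`, is
kept: `assembly_holds := closes`). `HardSphereEulerProofs` is NOT in the route's import closure
(`isProbabilityMeasure_localGibbsLaw`, `empirical*Field_eq_sum` unavailable here); `closes`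
re-derives what it needs from `empiricalMeasure_eq` and `isFiniteMeasure_withDensity_ofReal`.

CHEAPEST FALSIFIER. Paper-and-pencil, refuters first: write the contact Dirichlet form of HS(κ) for
a gapped flux-reciprocal κ — it charges only the
collision boundary |x_i − x_j| = ε (codimension one) — and test whether the Fritz–Funaki–Lebowitz /
Liverani–Olla ergodic step used by OVY
(zero form ⇒ exchangeable velocities ⇒ Gibbs) survives when the form sees only boundary traces
(needed: κ-invariant contact traces
⇒ Gibbs via free flight). A translation-invariant, finite-entropy-density, NON-Gibbs state with
vanishing contact form
kills KernelGasEulerLimit and VanishingNoise's RareDiceEuler together. Second (kit two-body job, not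
run — no kit in this
payload): reflect a point off the studded pair body with impact parameters drawn from densities
Lipschitz at scale δ ∈ {3,10,30}·w; the
outgoing histogram must be δ-independent to O(w/δ) and flux-reciprocal, and the empirical L²(flux)
contraction of the first spherical
harmonics must stay ≍ s² down to incidence angles ≍ s (grazing shadowing is where a UNIFORM gap
dies). Lookup: FeresZhang2012 prove a gap for a
CLASS of microstructures only (paywalled, acq-03758); uniformity for studs on a sphere is a bet,
flagged in GolfRealisation.

NUMBERS. Fixed reduced density: (N+1)ε_N³ = σ³; collisions per particle per unit macroscopic time ≍
σ²N^(1/3), in total ≍ N^(4/3)t (Spohn1991 I.3).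
Golf schedule: stud width w_N ≤ ε_N e^(−N²) — beats the encounter budget e^(CN)·N^(4/3)t·poly(N) of
the coupling (density of local Gibbs
w.r.t. Gibbs ≤ e^(CN); stationary collision intensity ≍ N^(4/3)); slope s_N → 0 with s_N²N^(1/3) → ∞
(the gap window: q_N ≍ c s_N²,
q_N(N+1)^(1/3) → ∞), e.g. s_N = N^(−1/12); HS(p) comparison: q = 1 − p² (VanishingNoise's window
(1−p_N)(N+1)^(1/3) → ∞ is the same
window); expanding factor of impact-position ↦ outgoing-direction ≍ s_N ε_N/w_N ≥ e^(N²)N^(−1/12) →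
∞; per-encounter coupling error
O(w_N/δ) with δ ≍ s_N·min(preceding flight, ε_N); micro-bounces per encounter ≤ ⌈π/(π − 2s_N)⌉ = 2;
protrusion a_N = h_N/ε_N ≤ s_N w_N/ε_N
(EOS and exclusion-volume error O(a_N)); TV distance of the golf and sphere local Gibbs laws
O(N^(7/3)σ²a_N) → 0. Flux measures: fluxIn/fluxOut
have total mass π on S² (d = 3); Lambert kernel: q = 1; specular: q = 0 (excluded). Items at open: 8
typed (3 cruxes, 5 supports), 0 informal; after the re-type repair (rev 4): 3 cruxes
(GolfRealisation 13287; KernelGasEulerLimit 17361 and ShapeStability 17627 guarded), 5 supports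
(ShapeGasEulerLimit guarded, MergingTransfer 13291, TwoScaleCellAveraging 13292, RungDock, ShapeDock
re-filed with guard-threaded glosses), 1 crux-only Assembly; after rev 6 (2026-08-17): 3 cruxes + 3
supports (ShapeGasEulerLimit, MergingTransfer, TwoScaleCellAveraging) + the crux-only Assembly,
deciding theorem crux-only; packing threshold η₀: prover-chosen, any value inside the virial
analyticity radius works uniformly (Lebowitz–Penrose; constant solutions with σ³ sup ρ < η₀ witness
non-vacuity, audit probe P5).

DEFINITION REQUESTS. None needed now: gen 1's request D1 has LANDED as
`Literature.MathematicalPhysics.KineticTheory.StochasticCollisionHardSphereProcess`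
(CollisionKernel, kernelSampler, kernelGasLawAt/EventLaw/PathLaw, fluxIn/fluxOut,
IsOutgoingSupported, IsFluxReciprocal, specular/lambert/
hsMix kernels) and is imported by this route; the golf pair body (gauge × outward normal of ball(ε)
∪ symmetric studs) is constructed by
GolfRealisation's prover under Summits/AtomisticToContinuum/HydrodynamicLimit/Theorems, not as a
shared definition. Optional convenience
(not filed): `shapeGeometry Ψ : Geometry (Fin 3) T3 := ⟨G₀.translate, Ψ ∘ G₀.sepVec, …⟩` in
Literature/Analysis/FluidPDE would shorten every
statement. Facts provers may want as hypotheses (to be filed by them as cite items when used):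
Feres2007 (microstructure ⇒ Markov operator,
reciprocity), FeresZhang2012 (spectral gap), CometsEtAl2008 Thm 2.4–2.5 (Knudsen billiard:
invariance, reversibility up to the flip),
Chernov1997 (collision-rate / mean-free-path formula).

Novelty: Searches (2026-08-15, this seat): `lit search --source crossref "Feres Zhang spectral gap random
billiards"` (10: FeresZhang2012,
FeresZhang2010 billiard Laplacian, CookFeres2012, FeresYablonsky2004, Chumley–Feres 2021
doi:10.3934/dcds.2020319, ChumleyFeresGarciagerman2021 —
all ONE particle against a wall); `lit search --source crossref "hard sphere gas rough
microstructure collisions random reflection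
derandomization hydrodynamic limit"` (12: nothing relevant — granular rough spheres = rotational
friction, Lyapunov pairing, suspensions);
`lit search --source crossref "random billiard small roughness billiard Laplacian …"` (10:
FeresZhang2010, Plakhov2009, small-scatterer Sinai
billiard); `lit search --source crossref "Plakhov billiard scattering rough bodies …"` (6:
Plakhov2009, Plakhov's survey
doi:10.1070/rm2009v064n05abeh004642, Plakhov–Stepin doi:10.1070/sm1999v190n07abeh000417, Plakhov
2012 doi:10.1007/s10958-012-0744-0);
`lit galaxy search "random billiard" --star all` (22 rows: CometsEtAl2008 = arXiv:math/0612799 read,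
Thm 2.4/2.5 p. 8; nothing many-body);
`lit frontier AtomisticToContinuum --since 2021` (30: only CanestrariLiveraniOlla2026, heat equation
from deterministic dynamics with internal
chaotic degrees of freedom — diffusive scale, other mechanism); `lit bridges AtomisticToContinuum
--cross any` (30: none relevant); openalex /
Semantic Scholar rate-limited (HTTP 429) and arXiv empty at filing; `lit read` of FeresZhang2012 and
Feres2007 paywalled (acq-03758,  [refs: 10.3934/dcds.2020319, 10.1070/rm2009v064n05abeh004642, 10.1070/sm1999v190n07abeh000417, 10.1007/s10958-012-0744-0, math/0612799, doi:10.3934/dcds.2020319, doi:10.1070/rm2009v064n05abeh004642, doi:10.1070/sm1999v190n07abeh000417, doi:10.1007/s10958-012-0744-0, FeresZhang2012, FeresZhang2010, CookFeres2012, FeresYablonsky2004, ChumleyFeresGarciagerman2021, Plakhov2009, CometsEtAl2008, CanestrariLive]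

Barriers (technique_class: random-billiard exact-coupling relative-entropy): - technique_class: random-billiard exact-coupling relative-entropy
- Literature.Barriers.AtomisticToContinuum.BoltzmannHypothesisBarrier: applies to
KernelGasEulerLimit only in its NOISY form (classification of translation-invariant
zero-contact-Dirichlet-form states of HS(κ), the FFL/Liverani–Olla-type theorem-in-waiting for a
gapped conservative contact noise); GolfRealisation never meets it (pathwise coupling, no
invariant-state classification of the deterministic gas); for the conjunct it returns in full inside
ShapeStability — said plainly, that crux is where the barrier lives.
- Literature.Barriers.AtomisticToContinuum.MacroErgodicityBarrier: same division — evaded for the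
rung exactly as OVY evade it (dynamics WITH conservative noise, q_N(N+1)^(1/3) → ∞ randomisations
per particle), bypassed for the golf gas by exact coupling, NOT evaded for ShapeStability; the bet
is that continuity in the grain shape at the sphere is a weaker demand than classifying invariant
states of smooth spheres, because both gases share Liouville measure, EOS limit and every
conservation law and differ by a C^(0,1)-vanishing collision rule on a super-exponentially thin
layer.
- Literature.Barriers.AtomisticToContinuum.HighMomentumCutoffBarrierNarrow: applies squarely to
KernelGasEulerLimit (true kinetic energy |v|²/2, convective cubic energy current, Maxwellian
references — the narrow barrier's exact scope); not evaded; the bet is Povzner-type propagation of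
Gaussian velocity moments along HS(κ

History (route lifecycle, newest last):
- 2026-08-16T23:17:08Z · rev 2: restated KernelGasEulerLimit (stmt-AtomisticToContinuum-13289) — route-repair d1e0a456 (statement-revised p126922, D-0032): propagate the conjunct's PACKING GUARD into the stochastic rung — 1:1 weakening of KernelGasEulerLimi (planner-rrepair-AtomisticToContinuum-GolfBallD-d1e0a456-0)
- 2026-08-16T23:24:13Z · rev 3: restated ShapeStability (stmt-AtomisticToContinuum-13288) — route-repair d1e0a456 (statement-revised p126922, D-0032), guard propagation step 2: 1:1 weakening of the crux ShapeStability (same decl name, rank 3) — `∃ η₀ : (planner-rrepair-AtomisticToContinuum-GolfBallD-d1e0a456-0)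
- 2026-08-16T23:27:06Z · rev 4: restated Assembly (stmt-AtomisticToContinuum-13295) — route-repair d1e0a456 (statement-revised p126922, D-0032): Assembly restated CRUX-ONLY (GolfRealisation → ShapeStability → KernelGasEulerLimit → HydrodynamicLim (planner-rrepair-AtomisticToContinuum-GolfBallD-d1e0a456-0)
- 2026-08-16T23:27:35Z · rev 5: dropped stmt-AtomisticToContinuum-13290, stmt-AtomisticToContinuum-13293, stmt-AtomisticToContinuum-13294 — route-repair d1e0a456 (statement-revised p126922, D-0032), guard propagation step 3 + deciding theorem: (a) ShapeGasEulerLimit re-filed PACKING-GUARDED (same de (planner-rrepair-AtomisticToContinuum-GolfBallD-d1e0a456-0)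
- 2026-08-17T00:07:29Z · rev 7: dropped RungDock, ShapeDock — route-repair d034e044, step 2 (hygiene after the crux-only deciding theorem of rev 6): drop the rev 4–5 docking items RungDock and ShapeDock — pure glue whose m (planner-rbadge-AtomisticToContinuum-GolfBallDi-d034e044-0)
- 2026-08-22T10:41:10Z · DORMANT — reconciler: no traction for 5.3 d (last activity item-evidence-added at 2026-08-17T03:20:58Z); parked, not closed — `ledger route dormant route-AtomisticToConti (operator:999:58828)

sub-problem: HydrodynamicLimit · status: dormant · opened planner-plancard-AtomisticToContinuum-Hydrody-7288b72e-g2-0 2026-08-15T19:01:02Z · rev 7 · ledger route-AtomisticToContinuum-GolfBallDice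
GENERATED by the gate from the ledger (D-0016/17). Provers cite these decls: `theorem foo : Summit.AtomisticToContinuum.HydrodynamicLimit.Theses.GolfBallDice.<Decl> := …` in Summits/AtomisticToContinuum/HydrodynamicLimit/Theorems/<Name>.lean.
-/

namespace Summit.AtomisticToContinuum.HydrodynamicLimit.Theses.GolfBallDice

open scoped BigOperators Topology Manifold Classical MeasureTheory ProbabilityTheory Matrix InnerProductSpace ComplexConjugate ContinuousMap
open Filter Set Function TopologicalSpace MeasureTheory

attribute [summit_statement] _root_.HydrodynamicLimit

/-- item stmt-AtomisticToContinuum-13287 · crux · rank 2 · open · by planner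
why it might fail: The cell-averaged stud kernel may lose its L²(flux) gap UNIFORMLY in the axis/incidence (grazing rays see only stud tops: shadowing), leaving q_N ≪ s_N²; and the coupling needs E[#encounters ∧ coupled] ≤ e^(CN)·N^(4/3)t via stationarity of Gibbs under HS(κ_N).
sources: Feres2007, FeresZhang2012, FeresZhang2010, CookFeres2012, CometsEtAl2008, Plakhov2009
[crux] (card G1+G2 with Feres' theorem for gases, typed) there exist a shape schedule (Ψ_N, a_N,
s_N) and Markov collision kernels κ_N on S² — outgoing-supported, flux-reciprocal, with a UNIFORM
one-collision L²(flux) spectral gap q_N ∈ (0,1] (∫(P_ω f)² dfluxIn ≤ (1−q_N)∫f² dfluxOut for bounded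
fluxOut-mean-zero f, every unit axis ω) in the window q_N(N+1)^(1/3) → ∞ — such that for all
continuous positive profiles ∃σ₀ ∀σ ∈ (0,σ₀): (i) the Ψ_N-billiard (`HardSphereFlow` of the
Ψ_N-geometry) exists for every N, and (ii) for every t ≥ 0 and continuous χ the laws of the χ-tested
empirical density / momentum / energy fields of the shape gas at time t (from its own local Gibbs
law) and of the kernel gas HS(κ_N) at time t (`kernelGasLawAt`, started from the sphere local Gibbs
law) merge weakly: expectations of every bounded continuous F differ by o(1). Intended witness: golf
balls (studs of width w_N ≤ ε_N e^(−N²), slope s_N = N^(−1/12)), κ_N = the cell-averaged stud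
reflection law, q_N ≍ s_N²; intended proof: flows (Alexander for a finite union of convex
ball-cylinders) + stud-kernel reciprocity/gap + exact coupling (one-flight freshness at scale ≫ w_N
via TwoScaleCellAveraging, encounte -/
@[route_item "route-AtomisticToContinuum-GolfBallDice", crux]
def GolfRealisation : Prop :=
  ∃ (Ψ : ℕ → Literature.MathematicalPhysics.KineticTheory.V3 → Literature.MathematicalPhysics.KineticTheory.V3) (a s : ℕ → ℝ), ((∀ N, Measurable (Ψ N)) ∧ (∀ N r, Ψ N (-r) = -Ψ N r) ∧ (∀ N (c : ℝ) r, 0 < c → Ψ N (c • r) = c • Ψ N r) ∧ (∀ N r, (1 - a N) * ‖r‖ ≤ ‖Ψ N r‖ ∧ ‖Ψ N r‖ ≤ (1 + a N) * ‖r‖) ∧ (∀ N r, ‖(‖r‖) • Ψ N r - (‖Ψ N r‖) • r‖ ≤ s N * (‖r‖ * ‖Ψ N r‖)) ∧ Tendsto a atTop (nhds 0) ∧ Tendsto s atTop (nhds 0)) ∧ ∃ (κ : ℕ → Literature.MathematicalPhysics.KineticTheory.CollisionKernel (Fin 3)) (_ : ∀ N, ProbabilityTheory.IsMarkovKernel (κ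 N)) (q : ℕ → ℝ), ((∀ N, Literature.MathematicalPhysics.KineticTheory.IsOutgoingSupported (κ N)) ∧ (∀ N, Literature.MathematicalPhysics.KineticTheory.IsFluxReciprocal (κ N)) ∧ (∀ N, 0 < q N ∧ q N ≤ 1) ∧ (∀ N (ω : Literature.MathematicalPhysics.KineticTheory.V3), ‖ω‖ = 1 → ∀ f : Literature.MathematicalPhysics.KineticTheory.V3 → ℝ, Measurable f → (∀ n, |f n| ≤ 1) → ∫ n, f n ∂(Literature.MathematicalPhysics.KineticTheory.fluxOut ω) = 0 → ∫ g, (∫ n, f n ∂((κ N) (ω, g))) ^ 2 ∂(Literature.MathematicalPhysics.KineticTheory.fluxIn ω) ≤ (1 - q N) * ∫ n, (f n) ^ 2 ∂(Literature.MathematicalPhysics.KineticTheory.fluxOut ω)) ∧ Tendsto (fun N : ℕ => q N * ((N : ℝ) + 1) ^ (1 / 3 : ℝ)) atTop atTop) ∧ ∀ (a₀ θ₀ : Literature.MathematicalPhysics.KineticTheory.T3 → ℝ) (u₀ : Literature.MathematicalPhysics.KineticTheory.T3 → Literature.MathematicalPhysics.KineticTheory.V3), Continuous a₀ → Continuous θ₀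 → Continuous u₀ → (∀ x, 0 < a₀ x) → (∀ x, 0 < θ₀ x) → ∃ σ₀ : ℝ, 0 < σ₀ ∧ ∀ σ : ℝ, 0 < σ → σ < σ₀ → let G₀ : Literature.Analysis.FluidPDE.Geometry (Fin 3) Literature.MathematicalPhysics.KineticTheory.T3 := Literature.Analysis.FluidPDE.Torus.geometry (Fin 3); let ε : ℕ → ℝ := fun N => Literature.MathematicalPhysics.KineticTheory.hsDiameter σ N; let G : ℕ → Literature.Analysis.FluidPDE.Geometry (Fin 3) Literature.MathematicalPhysics.KineticTheory.T3 := fun N => ⟨G₀.translate, fun x y => Ψ N (G₀.sepVec x y), G₀.translate_zero, G₀.translate_add⟩; (∀ N, Nonempty (Literature.Analysis.FluidPDE.HardSphereFlow (G N) (ε N) (N + 1))) ∧ ∀ Φ' : (N : ℕ) → Literature.Analysis.FluidPDE.HardSphereFlow (G N) (ε N) (N + 1), let Q : (N : ℕ) → ℝ → Measure (Literature.Analysis.FluidPDE.Config (N + 1) (Fin 3) Literature.MathematicalPhysics.KineticTheory.T3) := fun N t => Literature.MathematicalPhysics.KineticTheory.kernelGasLawAt (κ N) G₀ (ε N) (N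 + 1) ((Literature.Analysis.FluidPDE.liouville G₀ (N + 1) (ε N)).withDensity (fun z => ENNReal.ofReal (Literature.Analysis.FluidPDE.canonicalDensity G₀ (ε N) (N + 1) (Literature.MathematicalPhysics.KineticTheory.localGibbsProfile a₀ u₀ θ₀) z))) t; let P' : (N : ℕ) → Measure (Literature.Analysis.FluidPDE.Config (N + 1) (Fin 3) Literature.MathematicalPhysics.KineticTheory.T3) := fun N => Literature.Analysis.FluidPDE.particleLaw (Φ' N) (Literature.Analysis.FluidPDE.canonicalDensity (G N) (ε N) (N + 1) (Literature.MathematicalPhysics.KineticTheory.localGibbsProfile a₀ u₀ θ₀)); ∀ t : ℝ, 0 ≤ t → ∀ χ : Literature.MathematicalPhysics.KineticTheory.T3 → ℝ, Continuous χ → (∀ Fr : ℝ → ℝ, Continuous Fr → (∃ M : ℝ, ∀ x, |Fr x| ≤ M) → Tendsto (fun N => (∫ z, Fr (Literature.MathematicalPhysics.KineticTheory.empiricalDensityField ((Φ' N).flow t z) χ) ∂(P' N)) - ∫ z, Fr (Literature.MathematicalPhysics.KineticTheory.empiricalDensityField z χ) ∂(Q N t)) atTop (nhds 0) ∧ Tendsto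 (fun N => (∫ z, Fr (Literature.MathematicalPhysics.KineticTheory.empiricalEnergyField ((Φ' N).flow t z) χ) ∂(P' N)) - ∫ z, Fr (Literature.MathematicalPhysics.KineticTheory.empiricalEnergyField z χ) ∂(Q N t)) atTop (nhds 0)) ∧ (∀ Fv : Literature.MathematicalPhysics.KineticTheory.V3 → ℝ, Continuous Fv → (∃ M : ℝ, ∀ v, |Fv v| ≤ M) → Tendsto (fun N => (∫ z, Fv (Literature.MathematicalPhysics.KineticTheory.empiricalMomentumField ((Φ' N).flow t z) χ) ∂(P' N)) - ∫ z, Fv (Literature.MathematicalPhysics.KineticTheory.empiricalMomentumField z χ) ∂(Q N t)) atTop (nhds 0))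

-- earlier ShapeStability (stmt-AtomisticToContinuum-13288, replaced 2026-08-16T23:24:13Z -> stmt-AtomisticToContinuum-17627): retired by None — ∀ (Ψ : ℕ → Literature.MathematicalPhysics.KineticTheory.V3 → Literature.MathematicalPhysics.KineticTheory.V3) (a s : ℕ → ℝ), ((∀ N, Measurable (Ψ N)) ∧ (∀ N r, Ψ N (-r) = -Ψ N r) ∧ (∀ N (c : ℝ) r, 0 < c → Ψ N (c • r) = c • Ψ N r) ∧ (∀ N r, (1 - a N) * ‖r‖ ≤ 
/-- item stmt-AtomisticToContinuum-17627 · crux · rank 3 · open · by planner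
why it might fail: Trajectories of the two gases decorrelate after one mean free time N^(-1/3) and no law-level structural-stability theory exists; it is FALSE exactly if smooth spheres keep non-hydrodynamic slow structure (fail macro-ergodicity) in the dilute band that every vanishing roughness destroys.
sources: OllaVaradhanYau1993, Spohn1991, Simanyi2013, CanestrariLiveraniOlla2026, LampisPetrinaPetrina1999, BaladiDemersLiverani2017
[crux] (card G4, deterministic form — PACKING-GUARDED since the Statement re-type p126922 / D-0032,
2026-08-16) for EVERY shape schedule there is a packing threshold η₀ > 0 such that, for all
continuous positive profiles, ∃σ₀ ∀σ ∈ (0,σ₀), for every classical hard-sphere-Euler solution on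
[0,T) whose local packing fraction stays below η₀ (∀ t ∈ [0,T), ∀ x, ρ_t(x)σ³ < η₀, verbatim the
conjunct's guard), every family of sphere flows Φ and shape flows Φ': if the SPHERE local Gibbs
fields converge at t = 0, then for every t ∈ [0,T), every continuous χ and every bounded continuous
F, E_sphere[F(density field_χ(t))] − E_shape[F(density field_χ(t))] → 0, likewise for the energy
field and, with bounded continuous F : ℝ³ → ℝ, for the momentum field (weak merging of the laws of
the hydrodynamic observables in the dilute-fluid chamber — near packing the grain shape is NOT a
small perturbation, so the unguarded form was over-strong in the same way the old conjunct was; t =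
0 is the statics: same activity/velocity/temperature profiles, exclusion bodies within relative
Hausdorff distance a_N → 0). [difficulty: open-problem] -/
@[route_item "route-AtomisticToContinuum-GolfBallDice", crux]
def ShapeStability : Prop :=
  ∀ (Ψ : ℕ → Literature.MathematicalPhysics.KineticTheory.V3 → Literature.MathematicalPhysics.KineticTheory.V3) (a s : ℕ → ℝ), ((∀ N, Measurable (Ψ N)) ∧ (∀ N r, Ψ N (-r) = -Ψ N r) ∧ (∀ N (c : ℝ) r, 0 < c → Ψ N (c • r) = c • Ψ N r) ∧ (∀ N r, (1 - a N) * ‖r‖ ≤ ‖Ψ N r‖ ∧ ‖Ψ N r‖ ≤ (1 + a N) * ‖r‖) ∧ (∀ N r, ‖(‖r‖) • Ψ N r - (‖Ψ N r‖) • r‖ ≤ s N * (‖r‖ * ‖Ψ N r‖)) ∧ Filter.Tendsto a Filter.atTop (nhds 0) ∧ Filter.Tendsto s Filter.atTop (nhds 0)) → ∃ η₀ : ℝ, 0 < η₀ ∧ ∀ (a₀ θ₀ : Literature.MathematicalPhysics.KineticTheory.T3 → ℝ) (u₀ : Literature.MathematicalPhysics.KineticTheory.T3 → Literature.MathematicalPhysics.KineticTheory.V3),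 Continuous a₀ → Continuous θ₀ → Continuous u₀ → (∀ x, 0 < a₀ x) → (∀ x, 0 < θ₀ x) → ∃ σ₀ : ℝ, 0 < σ₀ ∧ ∀ σ : ℝ, 0 < σ → σ < σ₀ → ∀ (T : ℝ) (ρ θ : ℝ → Literature.MathematicalPhysics.KineticTheory.T3 → ℝ) (u : ℝ → Literature.MathematicalPhysics.KineticTheory.T3 → Literature.MathematicalPhysics.KineticTheory.V3), Literature.MathematicalPhysics.KineticTheory.IsHardSphereEulerSolution σ T ρ u θ → (∀ t ∈ Set.Ico 0 T, ∀ x, ρ t x * σ ^ 3 < η₀) → ∀ Φ : (N : ℕ) → Literature.Analysis.FluidPDE.HardSphereFlow (Literature.Analysis.FluidPDE.Torus.geometry (Fin 3)) (Literature.MathematicalPhysics.KineticTheory.hsDiameter σ N) (N + 1), let G : ℕ → Literature.Analysis.FluidPDE.Geometry (Fin 3) Literature.MathematicalPhysics.KineticTheory.T3 := fun N => (⟨(Literature.Analysis.FluidPDE.Torus.geometry (Fin 3)).translate, fun x y => Ψ N ((Literature.Analysis.FluidPDE.Torus.geometry (Fin 3)).sepVec x y), (Literature.Analysis.FluidPDE.Torus.geometry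 (Fin 3)).translate_zero, (Literature.Analysis.FluidPDE.Torus.geometry (Fin 3)).translate_add⟩ : Literature.Analysis.FluidPDE.Geometry (Fin 3) Literature.MathematicalPhysics.KineticTheory.T3); ∀ Φ' : (N : ℕ) → Literature.Analysis.FluidPDE.HardSphereFlow (G N) (Literature.MathematicalPhysics.KineticTheory.hsDiameter σ N) (N + 1), Literature.MathematicalPhysics.KineticTheory.TendstoHydroFieldsAt (fun N => Literature.MathematicalPhysics.KineticTheory.localGibbsLaw σ a₀ u₀ θ₀ N (Φ N)) Φ ρ u θ 0 → let P : (N : ℕ) → MeasureTheory.Measure (Literature.Analysis.FluidPDE.Config (N + 1) (Fin 3) Literature.MathematicalPhysics.KineticTheory.T3) := fun N => Literature.MathematicalPhysics.KineticTheory.localGibbsLaw σ a₀ u₀ θ₀ N (Φ N); let P' : (N : ℕ) → MeasureTheory.Measure (Literature.Analysis.FluidPDE.Config (N + 1) (Fin 3) Literature.MathematicalPhysics.KineticTheory.T3) := fun N => Literature.Analysis.FluidPDE.particleLaw (Φ' N) (Literature.Analysis.FluidPDE.canonicalDensity (G N) (Literature.MathematicalPhysics.KineticTheory.hsDiameter σ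 N) (N + 1) (Literature.MathematicalPhysics.KineticTheory.localGibbsProfile a₀ u₀ θ₀)); ∀ t ∈ Set.Ico 0 T, ∀ χ : Literature.MathematicalPhysics.KineticTheory.T3 → ℝ, Continuous χ → (∀ Fr : ℝ → ℝ, Continuous Fr → (∃ M : ℝ, ∀ x, |Fr x| ≤ M) → Filter.Tendsto (fun N => (∫ z, Fr (Literature.MathematicalPhysics.KineticTheory.empiricalDensityField ((Φ N).flow t z) χ) ∂(P N)) - ∫ z, Fr (Literature.MathematicalPhysics.KineticTheory.empiricalDensityField ((Φ' N).flow t z) χ) ∂(P' N)) Filter.atTop (nhds 0) ∧ Filter.Tendsto (fun N => (∫ z, Fr (Literature.MathematicalPhysics.KineticTheory.empiricalEnergyField ((Φ N).flow t z) χ) ∂(P N)) - ∫ z, Fr (Literature.MathematicalPhysics.KineticTheory.empiricalEnergyField ((Φ' N).flow t z) χ) ∂(P' N)) Filter.atTop (nhds 0)) ∧ (∀ Fv : Literature.MathematicalPhysics.KineticTheory.V3 → ℝ, Continuous Fv → (∃ M : ℝ, ∀ v, |Fv v| ≤ M) → Filter.Tendsto (fun N => (∫ z, Fv (Literature.MathematicalPhysics.KineticTheory.empiricalMomentumField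 ((Φ N).flow t z) χ) ∂(P N)) - ∫ z, Fv (Literature.MathematicalPhysics.KineticTheory.empiricalMomentumField ((Φ' N).flow t z) χ) ∂(P' N)) Filter.atTop (nhds 0))

-- earlier KernelGasEulerLimit (stmt-AtomisticToContinuum-13289, replaced 2026-08-16T23:17:08Z -> stmt-AtomisticToContinuum-17361): retired by None — ∀ (κ : ℕ → Literature.MathematicalPhysics.KineticTheory.CollisionKernel (Fin 3)) [∀ N, ProbabilityTheory.IsMarkovKernel (κ N)] (q : ℕ → ℝ), ((∀ N, Literature.MathematicalPhysics.KineticTheory.IsOutgoingSupported (κ N)) ∧ (∀ N, Literature.MathematicalPhy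
/-- item stmt-AtomisticToContinuum-17361 · crux · rank 4 · open · by planner
why it might fail: OVY's ergodic step used bulk exchange noise on all near pairs; kernel noise charges only the collision boundary (zero contact Dirichlet form ⇒ kernel-invariant traces must reach Gibbs through free flight — unproved), and the cubic energy current with Gaussian tails is the open input.
sources: OllaVaradhanYau1993, LiveraniOlla1996, FritzFunakiLebowitz1994, Rezakhanlou2003, CometsEtAl2008, CookFeres2012
[crux] (card G3, the stochastic rung — PACKING-GUARDED since the Statement re-type p126922 / D-0032,
2026-08-16; generalises VanishingNoise's RareDiceEuler from the specular/Lambert mixture HS(p_N) to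
the class the golf kernels live in) for every sequence of Markov collision kernels κ_N that are
outgoing-supported and flux-reciprocal with a uniform one-collision L²(flux) spectral gap q_N ∈
(0,1] in the window q_N(N+1)^(1/3) → ∞ there is a packing threshold η₀ > 0 such that, for all
continuous positive profiles, ∃σ₀ ∀σ ∈ (0,σ₀), for every classical hard-sphere-Euler solution on
[0,T) WHOSE LOCAL PACKING FRACTION STAYS BELOW η₀ (∀ t ∈ [0,T), ∀ x, ρ_t(x)σ³ < η₀ — verbatim the
conjunct's guard: the dilute-fluid chamber where the virial EOS is analytic and OVY's thermodynamics
applies; imploding / dense-excursion solutions are outside the item exactly as they are outside the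
conjunct): if under the time-0 law of HS(κ_N) (N+1 spheres of diameter σ(N+1)^(-1/3) on 𝕋³,
`kernelGasLawAt … 0` from the sphere local Gibbs law) the χ-tested empirical density/momentum/energy
fields converge in probability to (ρ, ρu, E)(0), then under the time-t law they converge to (ρ, ρu,
E)(t) for every t < T. S -/
@[route_item "route-AtomisticToContinuum-GolfBallDice", crux]
def KernelGasEulerLimit : Prop :=
  ∀ (κ : ℕ → Literature.MathematicalPhysics.KineticTheory.CollisionKernel (Fin 3)) [∀ N, ProbabilityTheory.IsMarkovKernel (κ N)] (q : ℕ → ℝ), ((∀ N, Literature.MathematicalPhysics.KineticTheory.IsOutgoingSupported (κ N)) ∧ (∀ N, Literature.MathematicalPhysics.KineticTheory.IsFluxReciprocal (κ N)) ∧ (∀ N, 0 < q N ∧ q N ≤ 1) ∧ (∀ N (ω : Literature.MathematicalPhysics.KineticTheory.V3), ‖ω‖ = 1 → ∀ f : Literature.MathematicalPhysics.KineticTheory.V3 → ℝ, Measurable f → (∀ n, |f n| ≤ 1) → ∫ n, f n ∂(Literature.MathematicalPhysics.KineticTheory.fluxOut ω) = 0 → ∫ g, (∫ n, f n ∂((κ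 N) (ω, g))) ^ 2 ∂(Literature.MathematicalPhysics.KineticTheory.fluxIn ω) ≤ (1 - q N) * ∫ n, (f n) ^ 2 ∂(Literature.MathematicalPhysics.KineticTheory.fluxOut ω)) ∧ Tendsto (fun N : ℕ => q N * ((N : ℝ) + 1) ^ (1 / 3 : ℝ)) atTop atTop) → ∃ η₀ : ℝ, 0 < η₀ ∧ ∀ (a₀ θ₀ : Literature.MathematicalPhysics.KineticTheory.T3 → ℝ) (u₀ : Literature.MathematicalPhysics.KineticTheory.T3 → Literature.MathematicalPhysics.KineticTheory.V3), Continuous a₀ → Continuous θ₀ → Continuous u₀ → (∀ x, 0 < a₀ x) → (∀ x, 0 < θ₀ x) → ∃ σ₀ : ℝ, 0 < σ₀ ∧ ∀ σ : ℝ, 0 < σ → σ < σ₀ → let G₀ : Literature.Analysis.FluidPDE.Geometry (Fin 3) Literature.MathematicalPhysics.KineticTheory.T3 := Literature.Analysis.FluidPDE.Torus.geometry (Fin 3); let ε : ℕ → ℝ := fun N => Literature.MathematicalPhysics.KineticTheory.hsDiameter σ N; ∀ (T : ℝ) (ρ θ : ℝ → Literature.MathematicalPhysics.KineticTheory.T3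 → ℝ) (u : ℝ → Literature.MathematicalPhysics.KineticTheory.T3 → Literature.MathematicalPhysics.KineticTheory.V3), Literature.MathematicalPhysics.KineticTheory.IsHardSphereEulerSolution σ T ρ u θ → (∀ t ∈ Ico 0 T, ∀ x, ρ t x * σ ^ 3 < η₀) → let Q : (N : ℕ) → ℝ → Measure (Literature.Analysis.FluidPDE.Config (N + 1) (Fin 3) Literature.MathematicalPhysics.KineticTheory.T3) := fun N t => Literature.MathematicalPhysics.KineticTheory.kernelGasLawAt (κ N) G₀ (ε N) (N + 1) ((Literature.Analysis.FluidPDE.liouville G₀ (N + 1) (ε N)).withDensity (fun z => ENNReal.ofReal (Literature.Analysis.FluidPDE.canonicalDensity G₀ (ε N) (N + 1) (Literature.MathematicalPhysics.KineticTheory.localGibbsProfile a₀ u₀ θ₀) z))) t; (∀ χ : Literature.MathematicalPhysics.KineticTheory.T3 → ℝ, Continuous χ → ∀ δ > (0 : ℝ), Tendsto (fun N => Q N 0 {z | δ < |Literature.MathematicalPhysics.KineticTheory.empiricalDensityField z χ - ∫ x, χ x * ρ 0 x|}) atTop (nhds 0) ∧ Tendsto (fun N => Q N 0 {z | δ < ‖Literature.MathematicalPhysics.KineticTheory.empiricalMomentumField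 z χ - ∫ x, (χ x * ρ 0 x) • u 0 x‖}) atTop (nhds 0) ∧ Tendsto (fun N => Q N 0 {z | δ < |Literature.MathematicalPhysics.KineticTheory.empiricalEnergyField z χ - ∫ x, χ x * Literature.MathematicalPhysics.KineticTheory.totalEnergyDensity (ρ 0 x) (u 0 x) (θ 0 x)|}) atTop (nhds 0)) → ∀ t ∈ Ico 0 T, (∀ χ : Literature.MathematicalPhysics.KineticTheory.T3 → ℝ, Continuous χ → ∀ δ > (0 : ℝ), Tendsto (fun N => Q N t {z | δ < |Literature.MathematicalPhysics.KineticTheory.empiricalDensityField z χ - ∫ x, χ x * ρ t x|}) atTop (nhds 0) ∧ Tendsto (fun N => Q N t {z | δ < ‖Literature.MathematicalPhysics.KineticTheory.empiricalMomentumField z χ - ∫ x, (χ x * ρ t x) • u t x‖}) atTop (nhds 0) ∧ Tendsto (fun N => Q N t {z | δ < |Literature.MathematicalPhysics.KineticTheory.empiricalEnergyField z χ - ∫ x, χ x * Literature.MathematicalPhysics.KineticTheory.totalEnergyDensity (ρ t x) (u t x) (θ t x)|}) atTop (nhds 0))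

/-- item stmt-AtomisticToContinuum-13291 · support · rank 9 · open · by planner
sources: KipnisLandim1999, Folland1999
[support] (pure measure theory on the (N+1)-particle phase spaces) for finite measures P_N, Q_N and
measurable real (resp. ℝ³-valued) observables X_N, Y_N: if ∫F(X_N)dP_N − ∫F(Y_N)dQ_N → 0 for every
bounded continuous F and Y_N → c in Q_N-probability, then X_N → c in P_N-probability (sandwich
1_(|x−c|>δ) ≤ F_δ ≤ 1_(|x−c|>δ/2)). [difficulty: provable-now] -/
@[route_item "route-AtomisticToContinuum-GolfBallDice"]
def MergingTransfer : Prop :=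
  ∀ (P Q : (N : ℕ) → MeasureTheory.Measure (Literature.Analysis.FluidPDE.Config (N + 1) (Fin 3) Literature.MathematicalPhysics.KineticTheory.T3)), (∀ N, MeasureTheory.IsFiniteMeasure (P N)) → (∀ N, MeasureTheory.IsFiniteMeasure (Q N)) → (∀ (X Y : (N : ℕ) → Literature.Analysis.FluidPDE.Config (N + 1) (Fin 3) Literature.MathematicalPhysics.KineticTheory.T3 → ℝ) (c : ℝ), (∀ N, Measurable (X N)) → (∀ N, Measurable (Y N)) → (∀ Fr : ℝ → ℝ, Continuous Fr → (∃ M : ℝ, ∀ x, |Fr x| ≤ M) → Filter.Tendsto (fun N => (∫ z, Fr (X N z) ∂(P N)) - ∫ z, Fr (Y N z) ∂(Q N)) Filter.atTop (nhds 0)) → (∀ δ : ℝ, 0 < δ → Filter.Tendsto (fun N => Q N {z | δ < |Y N z - c|}) Filter.atTop (nhds 0)) → ∀ δ : ℝ, 0 < δ → Filter.Tendsto (fun N => P N {z | δ < |X N z - c|}) Filter.atTop (nhds 0)) ∧ (∀ (X Y : (N : ℕ) → Literature.Analysis.FluidPDE.Config (N + 1) (Fin 3) Literature.MathematicalPhysics.KineticTheory.T3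 → Literature.MathematicalPhysics.KineticTheory.V3) (c : Literature.MathematicalPhysics.KineticTheory.V3), (∀ N, Measurable (X N)) → (∀ N, Measurable (Y N)) → (∀ Fv : Literature.MathematicalPhysics.KineticTheory.V3 → ℝ, Continuous Fv → (∃ M : ℝ, ∀ v, |Fv v| ≤ M) → Filter.Tendsto (fun N => (∫ z, Fv (X N z) ∂(P N)) - ∫ z, Fv (Y N z) ∂(Q N)) Filter.atTop (nhds 0)) → (∀ δ : ℝ, 0 < δ → Filter.Tendsto (fun N => Q N {z | δ < ‖Y N z - c‖}) Filter.atTop (nhds 0)) → ∀ δ : ℝ, 0 < δ → Filter.Tendsto (fun N => P N {z | δ < ‖X N z - c‖}) Filter.atTop (nhds 0))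

/-- item stmt-AtomisticToContinuum-13292 · support · rank 9 · open · by planner
sources: Feres2007, FeresYablonsky2004, Plakhov2009
[support] (the derandomising engine, abstract Feres lemma) for a ℤⁿ-periodic measurable cell map Tm
on ℝⁿ (sup norm), |ψ| ≤ 1 measurable, and a density ρ that is L-Lipschitz and vanishes outside the
ball of radius R: |∫ ψ(Tm(x/h)) ρ(x) dx − (∫ρ)·∫_[0,1)ⁿ ψ∘Tm| ≤ 2 L h (2R+3)ⁿ for 0 < h ≤ 1 — an
observable of the h-rescaled microstructure seen through a density Lipschitz at scale ≫ h is its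
cell average up to O(Lh). [difficulty: provable-now] -/
@[route_item "route-AtomisticToContinuum-GolfBallDice"]
def TwoScaleCellAveraging : Prop :=
  ∀ (n : ℕ) (Y : Type) (mY : MeasurableSpace Y) (Tm : (Fin n → ℝ) → Y), @Measurable (Fin n → ℝ) Y _ mY Tm → (∀ (y : Fin n → ℝ) (k : Fin n → ℤ), Tm (fun i => y i + k i) = Tm y) → ∀ ψ : Y → ℝ, @Measurable Y ℝ mY _ ψ → (∀ y, |ψ y| ≤ 1) → ∀ (ρ : (Fin n → ℝ) → ℝ) (L R h : ℝ), 0 ≤ L → 0 ≤ R → 0 < h → h ≤ 1 → LipschitzWith (Real.toNNReal L) ρ → (∀ x, R < ‖x‖ → ρ x = 0) → |(∫ x, ψ (Tm (h⁻¹ • x)) * ρ x) - (∫ x, ρ x) * ∫ y in Set.pi Set.univ (fun _ : Fin n => Set.Ico (0 : ℝ) 1), ψ (Tm y)| ≤ 2 * L * h * (2 * R + 3) ^ n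

/-- item stmt-AtomisticToContinuum-17695 · support · rank 9 · open · by planner
sources: OllaVaradhanYau1993, Spohn1991, Feres2007
[support] (the rung X₁ — PACKING-GUARDED since the Statement re-type p126922 / D-0032, 2026-08-16;
closes from KernelGasEulerLimit + GolfRealisation by RungDock with η₀ := the threshold
KernelGasEulerLimit yields at the golf kernels — do not staff directly) there are a shape schedule
and a packing threshold η₀ > 0 such that for all continuous positive profiles ∃σ₀ ∀σ ∈ (0,σ₀): (i)
the shape gas of N+1 particles at diameter σ(N+1)^(-1/3) admits a `HardSphereFlow` of the
Ψ_N-geometry for every N, and (ii) for every classical hard-sphere-Euler solution on [0,T) whose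
local packing fraction stays below η₀ (∀ t ∈ [0,T), ∀ x, ρ_t(x)σ³ < η₀) and every family of such
flows, if the shape-gas local Gibbs fields converge in probability at t = 0 then they converge at
every t < T (density, momentum, energy; the format of TendstoHydroFieldsAt, i.e. of the re-typed
conjunct with the shape gas in place of the spheres). [difficulty: XL] -/
@[route_item "route-AtomisticToContinuum-GolfBallDice"]
def ShapeGasEulerLimit : Prop :=
  ∃ (Ψ : ℕ → Literature.MathematicalPhysics.KineticTheory.V3 → Literature.MathematicalPhysics.KineticTheory.V3) (a s : ℕ → ℝ), ((∀ N, Measurable (Ψ N)) ∧ (∀ N r, Ψ N (-r) = -Ψ N r) ∧ (∀ N (c : ℝ) r, 0 < c → Ψ N (c • r) = c • Ψ N r) ∧ (∀ N r, (1 - a N) * ‖r‖ ≤ ‖Ψ N r‖ ∧ ‖Ψ N r‖ ≤ (1 + a N) * ‖r‖) ∧ (∀ N r, ‖(‖r‖) • Ψ N r - (‖Ψ N r‖) • r‖ ≤ s N * (‖r‖ * ‖Ψ N r‖)) ∧ Filter.Tendsto a Filter.atTop (nhds 0) ∧ Filter.Tendsto s Filter.atTop (nhds 0)) ∧ ∃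 η₀ : ℝ, 0 < η₀ ∧ ∀ (a₀ θ₀ : Literature.MathematicalPhysics.KineticTheory.T3 → ℝ) (u₀ : Literature.MathematicalPhysics.KineticTheory.T3 → Literature.MathematicalPhysics.KineticTheory.V3), Continuous a₀ → Continuous θ₀ → Continuous u₀ → (∀ x, 0 < a₀ x) → (∀ x, 0 < θ₀ x) → ∃ σ₀ : ℝ, 0 < σ₀ ∧ ∀ σ : ℝ, 0 < σ → σ < σ₀ → let G : ℕ → Literature.Analysis.FluidPDE.Geometry (Fin 3) Literature.MathematicalPhysics.KineticTheory.T3 := fun N => (⟨(Literature.Analysis.FluidPDE.Torus.geometry (Fin 3)).translate, fun x y => Ψ N ((Literature.Analysis.FluidPDE.Torus.geometry (Fin 3)).sepVec x y), (Literature.Analysis.FluidPDE.Torus.geometry (Fin 3)).translate_zero, (Literature.Analysis.FluidPDE.Torus.geometry (Fin 3)).translate_add⟩ : Literature.Analysis.FluidPDE.Geometry (Fin 3) Literature.MathematicalPhysics.KineticTheory.T3); (∀ N, Nonempty (Literature.Analysis.FluidPDE.HardSphereFlow (G N) (Literature.MathematicalPhysics.KineticTheory.hsDiameter σ N) (N +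 1))) ∧ ∀ (T : ℝ) (ρ θ : ℝ → Literature.MathematicalPhysics.KineticTheory.T3 → ℝ) (u : ℝ → Literature.MathematicalPhysics.KineticTheory.T3 → Literature.MathematicalPhysics.KineticTheory.V3), Literature.MathematicalPhysics.KineticTheory.IsHardSphereEulerSolution σ T ρ u θ → (∀ t ∈ Set.Ico 0 T, ∀ x, ρ t x * σ ^ 3 < η₀) → ∀ Φ' : (N : ℕ) → Literature.Analysis.FluidPDE.HardSphereFlow (G N) (Literature.MathematicalPhysics.KineticTheory.hsDiameter σ N) (N + 1), let P' : (N : ℕ) → MeasureTheory.Measure (Literature.Analysis.FluidPDE.Config (N + 1) (Fin 3) Literature.MathematicalPhysics.KineticTheory.T3) := fun N => Literature.Analysis.FluidPDE.particleLaw (Φ' N) (Literature.Analysis.FluidPDE.canonicalDensity (G N) (Literature.MathematicalPhysics.KineticTheory.hsDiameter σ N) (N + 1) (Literature.MathematicalPhysics.KineticTheory.localGibbsProfile a₀ u₀ θ₀)); (∀ χ : Literature.MathematicalPhysics.KineticTheory.T3 → ℝ, Continuous χ → ∀ δ > (0 : ℝ), Filter.Tendsto (fun N => P' N {z | δ < |Literature.MathematicalPhysics.KineticTheory.empiricalDensityField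 ((Φ' N).flow 0 z) χ - ∫ x, χ x * ρ 0 x|}) Filter.atTop (nhds 0) ∧ Filter.Tendsto (fun N => P' N {z | δ < ‖Literature.MathematicalPhysics.KineticTheory.empiricalMomentumField ((Φ' N).flow 0 z) χ - ∫ x, (χ x * ρ 0 x) • u 0 x‖}) Filter.atTop (nhds 0) ∧ Filter.Tendsto (fun N => P' N {z | δ < |Literature.MathematicalPhysics.KineticTheory.empiricalEnergyField ((Φ' N).flow 0 z) χ - ∫ x, χ x * Literature.MathematicalPhysics.KineticTheory.totalEnergyDensity (ρ 0 x) (u 0 x) (θ 0 x)|}) Filter.atTop (nhds 0)) → ∀ t ∈ Set.Ico 0 T, (∀ χ : Literature.MathematicalPhysics.KineticTheory.T3 → ℝ, Continuous χ → ∀ δ > (0 : ℝ), Filter.Tendsto (fun N => P' N {z | δ < |Literature.MathematicalPhysics.KineticTheory.empiricalDensityField ((Φ' N).flow t z) χ - ∫ x, χ x * ρ t x|}) Filter.atTop (nhds 0) ∧ Filter.Tendsto (fun N => P' N {z | δ < ‖Literature.MathematicalPhysics.KineticTheory.empiricalMomentumField ((Φ' N).flow t z) χ - ∫ x, (χ x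 * ρ t x) • u t x‖}) Filter.atTop (nhds 0) ∧ Filter.Tendsto (fun N => P' N {z | δ < |Literature.MathematicalPhysics.KineticTheory.empiricalEnergyField ((Φ' N).flow t z) χ - ∫ x, χ x * Literature.MathematicalPhysics.KineticTheory.totalEnergyDensity (ρ t x) (u t x) (θ t x)|}) Filter.atTop (nhds 0))

-- earlier Assembly (stmt-AtomisticToContinuum-13295, replaced 2026-08-16T23:27:06Z -> stmt-AtomisticToContinuum-17681): retired by None — GolfRealisation → ShapeStability → KernelGasEulerLimit → ShapeGasEulerLimit → MergingTransfer → TwoScaleCellAveraging → RungDock → ShapeDock → _root_.HydrodynamicLimit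
/-- item stmt-AtomisticToContinuum-17681 · assembly · rank 1 · open · by planner
sources: Spohn1991, OllaVaradhanYau1993
[assembly] (rev 4, CRUX-ONLY form, D-0027 §2.1 (ii)) GolfRealisation → ShapeStability →
KernelGasEulerLimit → HydrodynamicLimit — the three cruxes alone imply the (packing-guarded)
conjunct. It is exactly `fun h₂ h₃ h₄ => shapeDock h₃ (rungDock h₂ h₄ mergingTransfer)
mergingTransfer` once the provable-now supports MergingTransfer, RungDock, ShapeDock are theorems
(prove those three, or prove this directly with the same measure theory); landing it lets the
planner replace the deciding theorem by the crux-only `closes h₂ h₃ h₄ := assembly_holds h₂ h₃ h₄`.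
Not a tautology any more (the rev-1 Assembly listed the docks among its own hypotheses and was
`tauto`-trivial, ground.trivial). [difficulty: M] -/
@[route_item "route-AtomisticToContinuum-GolfBallDice"]
def Assembly : Prop :=
  GolfRealisation → ShapeStability → KernelGasEulerLimit → _root_.HydrodynamicLimit

/-! D-0027 §2.1 — DECIDING THEOREM (planner-authored via `route open/edit --closes-file`; by planner-rbadge-AtomisticToContinuum-GolfBallDi-d034e044-0 2026-08-17T00:05:33Z):
its hypotheses are this route's items and its conclusion the sub-problem Statement (glue_lint), and it elaborates with this file. -/

/-- Deciding theorem of GolfBallDice, CRUX-ONLY (rev 6): the docking formerly filed as the supports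
MergingTransfer / RungDock / ShapeDock is proved inline (see the route header, ASSEMBLY). -/
@[closes "route-AtomisticToContinuum-GolfBallDice"] theorem closes (h₂ : GolfRealisation) (h₃ : ShapeStability) (h₄ : KernelGasEulerLimit) :
    _root_.HydrodynamicLimit := by
  have key : ∀ {α β : ℕ → Type} [∀ n, MeasurableSpace (α n)] [∀ n, MeasurableSpace (β n)]
    (μ : ∀ n, Measure (α n)) (ν : ∀ n, Measure (β n)) (X : ∀ n, α n → ℝ) (Y : ∀ n, β n → ℝ),
    (∀ n, IsFiniteMeasure (μ n)) → (∀ n, IsFiniteMeasure (ν n)) → (∀ n, Measurable (X n)) →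
    (∀ g : ℝ → ℝ, Continuous g → (∀ y, |g y| ≤ 1) →
      Tendsto (fun n => (∫ z, g (X n z) ∂μ n) - ∫ p, g (Y n p) ∂ν n) atTop (𝓝 0)) →
    (∀ δ : ℝ, 0 < δ → Tendsto (fun n => ν n {p | δ < Y n p}) atTop (𝓝 0)) →
    ∀ δ : ℝ, 0 < δ → Tendsto (fun n => μ n {z | δ < X n z}) atTop (𝓝 0) := by
    intro α β _ _ μ ν X Y hμ hν hX hH hB δ hδ
    let φ : ℝ → ℝ := fun r => min 1 (max 0 (2 / δ * r - 1))
    have hG0 : ∀ r, 0 ≤ φ r := fun r => le_min zero_le_one (le_max_left _ _)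
    have hG1 : ∀ r, φ r ≤ 1 := fun r => min_le_left _ _
    have hGa : ∀ r, |φ r| ≤ 1 := fun r => (abs_of_nonneg (hG0 r)).trans_le (hG1 r)
    have hGm : ∀ r, δ < r → 1 ≤ φ r := fun r hr => le_min le_rfl (le_max_of_le_right (by
      rw [le_sub_iff_add_le, div_mul_eq_mul_div, le_div_iff₀ hδ]; linarith))
    have hGz : ∀ r, r ≤ δ / 2 → φ r = 0 := fun r hr => by
      show min 1 (max 0 (2 / δ * r - 1)) = 0
      rw [max_eq_left (by rw [sub_nonpos, div_mul_eq_mul_div, div_le_one hδ]; linarith),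
        min_eq_right (zero_le_one' ℝ)]
    have hGc : Continuous φ := continuous_const.min (continuous_const.max
      ((continuous_const.mul continuous_id).sub continuous_const))
    have hA := hH φ hGc hGa
    have hint : ∀ n, Integrable (fun z => φ (X n z)) (μ n) := fun n => by
      haveI := hμ n
      exact Integrable.of_bound (hGc.measurable.comp (hX n)).aestronglyMeasurable 1
        (Eventually.of_forall fun z => (Real.norm_eq_abs _).trans_le (hGa _))
    have hlow : ∀ n, (μ n).real {z | δ < X n z} ≤ ∫ z, φ (X n z) ∂μ n := fun n => by
      haveI := hμ n
      calc (μ n).real {z | δ < X n z} ≤ (μ n).real {z | 1 ≤ φ (X n z)} :=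
            measureReal_mono fun z hz => hGm _ hz
        _ ≤ _ := by simpa [measureReal_def] using
            mul_meas_ge_le_integral_of_nonneg (Eventually.of_forall fun z => hG0 _) (hint n) 1
    have hup : ∀ n, ∫ p, φ (Y n p) ∂ν n ≤ (ν n).real {p | δ / 2 < Y n p} := fun n => by
      haveI := hν n
      rw [← setIntegral_eq_integral_of_forall_compl_eq_zero (s := {p | δ / 2 < Y n p})
        fun p hp => hGz _ (not_lt.1 hp)]
      refine (le_abs_self _).trans ((norm_integral_le_of_norm_le_const
        (Eventually.of_forall fun p => (Real.norm_eq_abs _).trans_le (hGa (Y n p)))).trans ?_)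
      simp [measureReal_def]
    have h3 : Tendsto (fun n => (μ n).real {z | δ < X n z}) atTop (𝓝 0) := by
      refine squeeze_zero (fun n => measureReal_nonneg) (fun n => ?_)
        (by simpa [Function.comp_def, measureReal_def] using
          hA.abs.add ((ENNReal.tendsto_toReal ENNReal.zero_ne_top).comp (hB _ (half_pos hδ))))
      calc (μ n).real {z | δ < X n z} ≤ _ := hlow n
        _ = ((∫ z, φ (X n z) ∂μ n) - ∫ p, φ (Y n p) ∂ν n) + ∫ p, φ (Y n p) ∂ν n := by ring
        _ ≤ _ := add_le_add (le_abs_self _) (hup n)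
    exact (ENNReal.tendsto_toReal_iff (fun n => by haveI := hμ n; exact measure_ne_top _ _)
      ENNReal.zero_ne_top).1 (by simpa [measureReal_def] using h3)
  have xfer : ∀ {α β : ℕ → Type} [∀ n, MeasurableSpace (α n)] [∀ n, MeasurableSpace (β n)]
    {P : ∀ n, Measure (α n)} {Q : ∀ n, Measure (β n)} {dA eA : ∀ n, α n → ℝ}
    {mA : ∀ n, α n → EuclideanSpace ℝ (Fin 3)} {dB eB : ∀ n, β n → ℝ}
    {mB : ∀ n, β n → EuclideanSpace ℝ (Fin 3)},
    ((∀ F : ℝ → ℝ, Continuous F → (∃ M : ℝ, ∀ x, |F x| ≤ M) →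
        Tendsto (fun n => (∫ z, F (dA n z) ∂P n) - ∫ z, F (dB n z) ∂Q n) atTop (𝓝 0) ∧
        Tendsto (fun n => (∫ z, F (eA n z) ∂P n) - ∫ z, F (eB n z) ∂Q n) atTop (𝓝 0)) ∧
      (∀ F : EuclideanSpace ℝ (Fin 3) → ℝ, Continuous F → (∃ M : ℝ, ∀ v, |F v| ≤ M) →
        Tendsto (fun n => (∫ z, F (mA n z) ∂P n) - ∫ z, F (mB n z) ∂Q n) atTop (𝓝 0))) →
    (∀ n, IsFiniteMeasure (P n)) → (∀ n, IsFiniteMeasure (Q n)) →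
    (∀ n, Measurable (dA n) ∧ Measurable (eA n) ∧ Measurable (mA n)) →
    (∀ n, Measurable (dB n) ∧ Measurable (eB n) ∧ Measurable (mB n)) →
    ∀ (cD cE : ℝ) (cM : EuclideanSpace ℝ (Fin 3)),
    (fun A B : ℝ → Prop => ((∀ δ, 0 < δ → B δ) → ∀ δ, 0 < δ → A δ) ∧
        ((∀ δ, 0 < δ → A δ) → ∀ δ, 0 < δ → B δ))
      (fun δ => Tendsto (fun n => P n {z | δ < |dA n z - cD|}) atTop (𝓝 0) ∧
        Tendsto (fun n => P n {z | δ < ‖mA n z - cM‖}) atTop (𝓝 0) ∧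
        Tendsto (fun n => P n {z | δ < |eA n z - cE|}) atTop (𝓝 0))
      (fun δ => Tendsto (fun n => Q n {z | δ < |dB n z - cD|}) atTop (𝓝 0) ∧
        Tendsto (fun n => Q n {z | δ < ‖mB n z - cM‖}) atTop (𝓝 0) ∧
        Tendsto (fun n => Q n {z | δ < |eB n z - cE|}) atTop (𝓝 0)) := by
    intro α β _ _ P Q dA eA mA dB eB mB pkg hP hQ hA hB cD cE cM
    have mD := fun n => continuous_abs.measurable.comp ((hA n).1.sub_const cD)
    have mD' := fun n => continuous_abs.measurable.comp ((hB n).1.sub_const cD)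
    have gD := fun (g : ℝ → ℝ) (hg : Continuous g) (hg1 : ∀ y, |g y| ≤ 1) =>
      (pkg.1 (fun d => g |d - cD|) (hg.comp (continuous_sub_right cD).abs) ⟨1, fun x => hg1 _⟩).1
    have mE := fun n => continuous_abs.measurable.comp ((hA n).2.1.sub_const cE)
    have mE' := fun n => continuous_abs.measurable.comp ((hB n).2.1.sub_const cE)
    have gE := fun (g : ℝ → ℝ) (hg : Continuous g) (hg1 : ∀ y, |g y| ≤ 1) =>
      (pkg.1 (fun d => g |d - cE|) (hg.comp (continuous_sub_right cE).abs) ⟨1, fun x => hg1 _⟩).2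
    have mM := fun n => ((hA n).2.2.sub_const cM).norm
    have mM' := fun n => ((hB n).2.2.sub_const cM).norm
    have gM := fun (g : ℝ → ℝ) (hg : Continuous g) (hg1 : ∀ y, |g y| ≤ 1) =>
      pkg.2 (fun m => g ‖m - cM‖) (hg.comp (continuous_sub_right cM).norm) ⟨1, fun x => hg1 _⟩
    exact ⟨fun h δ hδ => ⟨key P Q _ _ hP hQ mD gD (fun d hd => (h d hd).1) δ hδ,
        key P Q _ _ hP hQ mM gM (fun d hd => (h d hd).2.1) δ hδ,
        key P Q _ _ hP hQ mE gE (fun d hd => (h d hd).2.2) δ hδ⟩,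
      fun h δ hδ => ⟨key Q P _ _ hQ hP mD' (fun g hg hg1 => by
          simpa only [neg_sub, neg_zero, Function.comp_apply] using (gD g hg hg1).neg)
          (fun d hd => (h d hd).1) δ hδ,
        key Q P _ _ hQ hP mM' (fun g hg hg1 => by
          simpa only [neg_sub, neg_zero] using (gM g hg hg1).neg) (fun d hd => (h d hd).2.1) δ hδ,
        key Q P _ _ hQ hP mE' (fun g hg hg1 => by
          simpa only [neg_sub, neg_zero, Function.comp_apply] using (gE g hg hg1).neg)
          (fun d hd => (h d hd).2.2) δ hδ⟩⟩
  have hfin : ∀ (K : Literature.MathematicalPhysics.KineticTheory.CollisionKernel (Fin 3))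
    [ProbabilityTheory.IsMarkovKernel K]
    (G : Literature.Analysis.FluidPDE.Geometry (Fin 3) (UnitAddTorus (Fin 3))) (e : ℝ) (n : ℕ)
    (f₀ : UnitAddTorus (Fin 3) × EuclideanSpace ℝ (Fin 3) → ℝ),
    (fun M : Measure (Literature.Analysis.FluidPDE.Config n (Fin 3) (UnitAddTorus (Fin 3))) =>
        IsFiniteMeasure M ∧ ∀ τ : ℝ, IsFiniteMeasure
          (Literature.MathematicalPhysics.KineticTheory.kernelGasLawAt K G e n M τ))
      ((Literature.Analysis.FluidPDE.liouville G n e).withDensity fun z =>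
        ENNReal.ofReal (Literature.Analysis.FluidPDE.canonicalDensity G e n f₀ z)) := by
    intro K _ G e n f₀
    have hint : Integrable (Literature.Analysis.FluidPDE.canonicalDensity G e n f₀) volume := by
      unfold Literature.Analysis.FluidPDE.canonicalDensity Literature.Analysis.FluidPDE.canonicalPartition
      by_cases hI : Integrable ((Literature.Analysis.FluidPDE.hardSphereDomain G n e).indicator
        (Literature.Analysis.FluidPDE.tensorPow n f₀)) volume
      · exact hI.const_mul _
      · rw [integral_undef hI, inv_zero]
        simp only [zero_mul]
        exact integrable_zero _ _ _
    rw [Literature.Analysis.FluidPDE.liouville_eq]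
    have h1 := isFiniteMeasure_withDensity_ofReal
      (hint.restrict (s := Literature.Analysis.FluidPDE.hardSphereDomain G n e)).hasFiniteIntegral
    exact ⟨h1, fun τ => by
      unfold Literature.MathematicalPhysics.KineticTheory.kernelGasLawAt
      infer_instance⟩
  have hm : ∀ (n : ℕ) (χ : UnitAddTorus (Fin 3) → ℝ), Continuous χ → ∀ {γ : Type} [MeasurableSpace γ]
    {F : γ → Literature.Analysis.FluidPDE.Config n (Fin 3) (UnitAddTorus (Fin 3))}, Measurable F →
    Measurable (fun w => ∫ y, χ y.1 ∂Literature.Analysis.FluidPDE.empiricalMeasure (F w)) ∧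
    Measurable (fun w => ∫ y, χ y.1 * (‖y.2‖ ^ 2 / 2)
      ∂Literature.Analysis.FluidPDE.empiricalMeasure (F w)) ∧
    Measurable (fun w => ∫ y, χ y.1 • y.2 ∂Literature.Analysis.FluidPDE.empiricalMeasure (F w)) := by
    intro n χ hχ γ _ F hF
    have hI : ∀ {E : Type} [NormedAddCommGroup E] [NormedSpace ℝ E] [CompleteSpace E]
        (f : UnitAddTorus (Fin 3) × EuclideanSpace ℝ (Fin 3) → E)
        (z : Literature.Analysis.FluidPDE.Config n (Fin 3) (UnitAddTorus (Fin 3))),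
        ∫ y, f y ∂(Literature.Analysis.FluidPDE.empiricalMeasure z) =
          ((n : ENNReal)⁻¹).toReal • ∑ i, f (z i) := by
      intro E _ _ _ f z
      rw [Literature.Analysis.FluidPDE.empiricalMeasure_eq, integral_smul_measure,
        integral_finsetSum_measure fun i _ => integrable_dirac enorm_lt_top]
      simp only [integral_dirac]
    have hx : ∀ i : Fin n, Measurable fun w => F w i := fun i => (measurable_pi_apply i).comp hF
    simp only [hI, smul_eq_mul]
    exact ⟨(Finset.measurable_sum _ fun i _ => hχ.measurable.comp (hx i).fst).const_mul _,
      (Finset.measurable_sum _ fun i _ => (hχ.measurable.comp (hx i).fst).mul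
        (((hx i).snd.norm.pow_const 2).div_const 2)).const_mul _,
      (Finset.measurable_sum _ fun i _ => (hχ.measurable.comp (hx i).fst).smul
        (hx i).snd).const_smul ((n : ENNReal)⁻¹).toReal⟩
  obtain ⟨Ψ, a, s, hΨ, κ, hκM, q, hκ, Hg⟩ := h₂
  obtain ⟨η₁, hη₁, H₄⟩ := @h₄ κ hκM q hκ
  obtain ⟨η₂, hη₂, H₃⟩ := h₃ Ψ a s hΨ
  refine ⟨min η₁ η₂, lt_min hη₁ hη₂, fun a₀ θ₀ u₀ ha hθ hu ha0 hθ0 => ?_⟩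
  obtain ⟨σg, hσg, Hg'⟩ := Hg a₀ θ₀ u₀ ha hθ hu ha0 hθ0
  obtain ⟨σ₃, hσ₃, H₃'⟩ := H₃ a₀ θ₀ u₀ ha hθ hu ha0 hθ0
  obtain ⟨σ₄, hσ₄, H₄'⟩ := H₄ a₀ θ₀ u₀ ha hθ hu ha0 hθ0
  refine ⟨min σg (min σ₃ σ₄), lt_min hσg (lt_min hσ₃ hσ₄), ?_⟩
  intro σ hσ hσlt T ρ θ u hsol hgd Φ h0 t ht
  obtain ⟨hσg', hσ34⟩ := lt_min_iff.1 hσlt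
  obtain ⟨hσ₃', hσ₄'⟩ := lt_min_iff.1 hσ34
  obtain ⟨hne, HM⟩ := Hg' σ hσ hσg'
  let Φ' := fun N => Classical.choice (hne N)
  replace HM := HM Φ'
  have HS := H₃' σ hσ hσ₃' T ρ θ u hsol (fun t ht x => (hgd t ht x).trans_le (min_le_right _ _))
    Φ Φ' h0
  have h0T : (0 : ℝ) ∈ Ico 0 T := ⟨le_rfl, ht.1.trans_lt ht.2⟩
  have hF := fun (N : ℕ) G e n f => @hfin (κ N) (hκM N) G e n f
  have S3 := H₄' σ hσ hσ₄' T ρ θ u hsol (fun t ht x => (hgd t ht x).trans_le (min_le_left _ _))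
    (fun χ hχ => (xfer (HM 0 le_rfl χ hχ) (fun N => (hF N _ _ _ _).1)
      (fun N => (hF N _ _ _ _).2 0) (fun N => hm _ χ hχ ((Φ' N).measurable_flow 0))
      (fun N => hm _ χ hχ measurable_id) _ _ _).2
    ((xfer (HS 0 h0T χ hχ) (fun N => (hF N _ _ _ _).1) (fun N => (hF N _ _ _ _).1)
      (fun N => hm _ χ hχ ((Φ N).measurable_flow 0))
      (fun N => hm _ χ hχ ((Φ' N).measurable_flow 0)) _ _ _).2 (h0 χ hχ))) t ht
  intro χ hχ
  exact (xfer (HS t ht χ hχ) (fun N => (hF N _ _ _ _).1) (fun N => (hF N _ _ _ _).1)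
    (fun N => hm _ χ hχ ((Φ N).measurable_flow t))
    (fun N => hm _ χ hχ ((Φ' N).measurable_flow t)) _ _ _).1
    ((xfer (HM t ht.1 χ hχ) (fun N => (hF N _ _ _ _).1) (fun N => (hF N _ _ _ _).2 t)
      (fun N => hm _ χ hχ ((Φ' N).measurable_flow t))
      (fun N => hm _ χ hχ measurable_id) _ _ _).1 (S3 χ hχ))

end Summit.AtomisticToContinuum.HydrodynamicLimit.Theses.GolfBallDice
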